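import Literature.Analysis.Hypoelliptic.Amplitude
import Literature.Analysis.Hypoelliptic.Smoothness
import Mathlib.Analysis.Fourier.FourierTransformDeriv
import Mathlib.Analysis.Fourier.Inversion
import Mathlib.Analysis.Calculus.ParametricIntegral
import Mathlib.Analysis.Calculus.ContDiff.FiniteDimension
import HarnessLib

/-!
# Amplitude operators: differentiation under the integral, composition with `ᵗL`, and the Fourier side

Analysis/Hypoelliptic support file serving the discharge of the named fact
`Literature.Analysis.Distribution.Folland1995_cor634` (Folland 1995, Cor. (6.34)), continuing
`Amplitude.lean`.

For an amplitude `a` of order `m` (`IsAmp a m`) and a Fourier datum `F ∈ Nice` (all weighted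
`L²` norms finite; e.g. `F = 𝓕g`, `g` Schwartz) the **amplitude operator** is
`ampOp a F (x) = ∫ e^{2πi⟨ξ, x⟩} a(x, ξ) F(ξ) dξ` (for `a = a(x)` this is `a · 𝓕⁻¹F`).

* **Differentiation under the integral** (`hasFDerivAt_ampOp`): `ampOp a F` is smooth
  (`contDiff_ampOp`), compactly supported in the `x`-support of `a`, and the complexified
  transposes of `Amplitude.lean` act through the twisted calculus:
  `Z_x (ampOp a F) = ampOp (twD Z a) F`, …, **`opC (ampOp a F) = ampOp (twOp a) F`**
  (`opC_ampOp`: a differential operator composed with an amplitude operator is the amplitude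
  operator of the twisted amplitude — the exact composition formula).
* **The Fourier side** (`fourier_ampOp`): `𝓕 (ampOp a F) = kerOp (ampKer a) F` with the kernel
  `ampKer a η ξ = 𝓕(a(·, ξ))(η - ξ)`, which is certified of order `m` (`IsAmp.kerDecay_ampKer`:
  rapid decay in `η - ξ` from the `x`-derivative bounds, by the Riemann–Lebesgue-type estimate
  `‖ζ‖^N ‖𝓕f(ζ)‖ ≲ ∑_{j ≤ N} ∫ ‖D^j f‖` of Mathlib); hence the **Sobolev bound**
  `‖ampOp a F‖_{s-m} ≤ C ‖F‖_s` on the Fourier side (`IsAmp.exists_wnorm_fourier_ampOp_le`,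
  Taylor 1981, Ch. II, Thm 6.? for pseudo-differential operators; here the elementary
  amplitude version via the Schur test of `WeightedL2.lean`).

## References

* M. E. Taylor, *Pseudodifferential Operators* (1981), Ch. II §§1–6 (folklore).
* G. B. Folland, *Introduction to Partial Differential Equations*, 2nd ed. (1995), Ch. 6 §C, Ch. 8.
-/

noncomputable section

open MeasureTheory Set Filter Function TopologicalSpace Real
open scoped Topology InnerProductSpace BigOperators ContDiff ComplexConjugate FourierTransform ENNReal

namespace Literature.Analysis.Hypoelliptic

open Literature.Analysis.Distribution

variable {V : Type*} [NormedAddCommGroup V] [InnerProductSpace ℝ V] [FiniteDimensional ℝ V]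
  [MeasurableSpace V] [BorelSpace V]

/-! ### The phase and the amplitude operator -/

/-- The phase `e^{2πi⟨ξ, x⟩}`. [folklore] -/
def phase (ξ x : V) : ℂ := Complex.exp (↑(2 * π * ⟪ξ, x⟫_ℝ) * Complex.I)

omit [FiniteDimensional ℝ V] [MeasurableSpace V] [BorelSpace V] in
/-- `|e^{2πi⟨ξ, x⟩}| = 1`. [folklore] -/
@[simp] theorem norm_phase (ξ x : V) : ‖phase ξ x‖ = 1 := by
  unfold phase; exact Complex.norm_exp_ofReal_mul_I _

omit [FiniteDimensional ℝ V] [MeasurableSpace V] [BorelSpace V] in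
/-- The phase is jointly continuous. [folklore] -/
@[fun_prop] theorem continuous_phase : Continuous (uncurry (phase (V := V))) := by
  unfold phase; fun_prop

omit [FiniteDimensional ℝ V] [MeasurableSpace V] [BorelSpace V] in
/-- The phase is continuous in `ξ`. [folklore] -/
@[fun_prop] theorem continuous_phase_left (x : V) : Continuous fun ξ => phase ξ x := by
  unfold phase; fun_prop

omit [FiniteDimensional ℝ V] [MeasurableSpace V] [BorelSpace V] in
/-- The linear form `v ↦ ⟨ξ, v⟩` with complex values. [folklore] -/
def innerC (ξ : V) : V →L[ℝ] ℂ := (innerSL ℝ ξ).smulRight (1 : ℂ)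

omit [FiniteDimensional ℝ V] [MeasurableSpace V] [BorelSpace V] in
/-- (structural lemma) [folklore] -/
@[simp] theorem innerC_apply (ξ v : V) : innerC ξ v = ((⟪ξ, v⟫_ℝ : ℝ) : ℂ) := by
  simp [innerC]

omit [FiniteDimensional ℝ V] [MeasurableSpace V] [BorelSpace V] in
/-- `‖innerC ξ‖ ≤ ‖ξ‖`. [folklore] -/
theorem norm_innerC_le (ξ : V) : ‖innerC ξ‖ ≤ ‖ξ‖ := by
  refine ContinuousLinearMap.opNorm_le_bound _ (norm_nonneg ξ) fun v => ?_
  rw [innerC_apply, Complex.norm_real]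
  exact (abs_real_inner_le_norm ξ v)

omit [FiniteDimensional ℝ V] [MeasurableSpace V] [BorelSpace V] in
/-- `ξ ↦ innerC ξ` is continuous. [folklore] -/
theorem continuous_innerC : Continuous (innerC (V := V)) := by
  unfold innerC
  exact ((ContinuousLinearMap.smulRightL ℝ V ℂ).continuous₂).comp₂ (innerSL ℝ).continuous continuous_const

omit [FiniteDimensional ℝ V] [MeasurableSpace V] [BorelSpace V] in
/-- **The derivative of the phase in `x`**: `D_x e^{2πi⟨ξ,x⟩} = 2πi e^{2πi⟨ξ,x⟩} ⟨ξ, ·⟩`. [folklore] -/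
theorem hasFDerivAt_phase (ξ x : V) :
    HasFDerivAt (fun y => phase ξ y) ((2 * π * Complex.I * phase ξ x) • innerC ξ) x := by
  have h2 : HasFDerivAt (fun y : V => ((⟪ξ, y⟫_ℝ : ℝ) : ℂ)) (innerC ξ) x := by
    have h := Complex.ofRealCLM.hasFDerivAt.comp x (innerSL ℝ ξ).hasFDerivAt
    refine (h.congr_fderiv ?_)
    ext v; simp [innerC]
  have h3 : HasFDerivAt (fun y : V => (2 * π * Complex.I) * ((⟪ξ, y⟫_ℝ : ℝ) : ℂ))
      ((2 * π * Complex.I) • innerC ξ) x := h2.const_mul _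
  have h4 := h3.cexp
  have e : (fun y => phase ξ y) = fun y => Complex.exp ((2 * π * Complex.I) * ((⟪ξ, y⟫_ℝ : ℝ) : ℂ)) := by
    ext y; simp only [phase]; congr 1; push_cast; ring
  rw [e]
  refine h4.congr_fderiv ?_
  have e2 : Complex.exp (2 * ↑π * Complex.I * ((⟪ξ, x⟫_ℝ : ℝ) : ℂ)) = phase ξ x := by
    simp only [phase]; congr 1; push_cast; ring
  rw [smul_smul, e2, mul_comm]

/-- **The amplitude operator** `ampOp a F (x) = ∫ e^{2πi⟨ξ, x⟩} a(x, ξ) F(ξ) dξ`. [folklore] -/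
def ampOp (a : V → V → ℂ) (F : V → ℂ) (x : V) : ℂ := ∫ ξ, phase ξ x * (a x ξ * F ξ)

/-- **The amplitude operator of a function of `x` alone is multiplication after `𝓕⁻¹`**:
`ampOp g F = g · 𝓕⁻¹F`. [folklore] -/
theorem ampOp_of_fun (g : V → ℂ) (F : V → ℂ) : ampOp (fun x _ => g x) F = fun x => g x * 𝓕⁻ F x := by
  ext x
  rw [ampOp, Real.fourierInv_eq', ← integral_const_mul]
  refine integral_congr_ae (Eventually.of_forall fun ξ => ?_)
  simp only [phase, smul_eq_mul]; ring

/-! ### Integrability against `Nice` data -/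

/-- A polynomially bounded measurable factor times a `Nice` datum is integrable. [folklore] -/
theorem Nice.integrable_mul {F : V → ℂ} (hF : Nice F) {G : V → ℂ} (hG : AEStronglyMeasurable G volume)
    {C p : ℝ} (hb : ∀ ξ, ‖G ξ‖ ≤ C * bw p ξ) : Integrable (fun ξ => G ξ * F ξ) := by
  refine ((integrable_bw_mul_norm_of_nice hF p).const_mul C).mono' (hG.mul hF.1) (Eventually.of_forall fun ξ => ?_)
  rw [norm_mul]
  calc ‖G ξ‖ * ‖F ξ‖ ≤ (C * bw p ξ) * ‖F ξ‖ := mul_le_mul_of_nonneg_right (hb ξ) (norm_nonneg _)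
    _ = C * (bw p ξ * ‖F ξ‖) := by ring

/-- The same for vector-valued (e.g. operator-valued) factors, with `•`. [folklore] -/
theorem Nice.integrable_smul {F : V → ℂ} (hF : Nice F) {W : Type*} [NormedAddCommGroup W] [NormedSpace ℂ W]
    {G : V → W} (hG : AEStronglyMeasurable G volume)
    {C p : ℝ} (hb : ∀ ξ, ‖G ξ‖ ≤ C * bw p ξ) : Integrable (fun ξ => F ξ • G ξ) := by
  refine ((integrable_bw_mul_norm_of_nice hF p).const_mul C).mono' (hF.1.smul hG) (Eventually.of_forall fun ξ => ?_)
  rw [norm_smul]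
  calc ‖F ξ‖ * ‖G ξ‖ ≤ ‖F ξ‖ * (C * bw p ξ) := mul_le_mul_of_nonneg_left (hb ξ) (norm_nonneg _)
    _ = C * (bw p ξ * ‖F ξ‖) := by ring

variable {a : V → V → ℂ} {m : ℝ} {F : V → ℂ}

/-- The integrand of `ampOp a F x` is integrable. [folklore] -/
theorem IsAmp.integrable_ampOp (ha : IsAmp a m) (hF : Nice F) (x : V) :
    Integrable (fun ξ => phase ξ x * (a x ξ * F ξ)) := by
  obtain ⟨C, _, hC⟩ := ha.norm_le
  have e : (fun ξ => phase ξ x * (a x ξ * F ξ)) = fun ξ => (phase ξ x * a x ξ) * F ξ := by ext ξ; ring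
  rw [e]
  refine hF.integrable_mul (((continuous_phase_left x).mul (ha.slice' x).continuous).aestronglyMeasurable)
    (C := C) (p := m) fun ξ => ?_
  rw [norm_mul, norm_phase, one_mul]; exact hC x ξ

/-! ### Differentiation under the integral -/

/-- The `x`-derivative of `e^{2πi⟨ξ,x⟩} a(x, ξ)` divided by the phase:
`D(x, ξ) = 2πi a(x, ξ) ⟨ξ, ·⟩ + D_x a(x, ξ)`. [folklore] -/
def ampD (a : V → V → ℂ) (x ξ : V) : V →L[ℝ] ℂ :=
  (2 * π * Complex.I * a x ξ) • innerC ξ + fderiv ℝ (fun y => a y ξ) x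

omit [FiniteDimensional ℝ V] [MeasurableSpace V] [BorelSpace V] in
/-- `ampD a x ξ (Z x) = twD Z a x ξ`. [folklore] -/
theorem ampD_apply (a : V → V → ℂ) (Z : V → V) (x ξ : V) : ampD a x ξ (Z x) = twD Z a x ξ := by
  simp only [ampD, twD, add_apply, FunLike.coe_smul, Pi.smul_apply,
    innerC_apply, smul_eq_mul]
  ring

omit [FiniteDimensional ℝ V] [MeasurableSpace V] [BorelSpace V] in
/-- The derivative of `x ↦ e^{2πi⟨ξ,x⟩} a(x, ξ)` is `e^{2πi⟨ξ,x⟩} D(x, ξ)`. [folklore] -/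
theorem IsAmp.hasFDerivAt_phase_mul (ha : IsAmp a m) (x ξ : V) :
    HasFDerivAt (fun y => phase ξ y * a y ξ) (phase ξ x • ampD a x ξ) x := by
  have h1 := hasFDerivAt_phase ξ x
  have h2 : HasFDerivAt (fun y => a y ξ) (fderiv ℝ (fun y => a y ξ) x) x :=
    (((ha.slice ξ).differentiable (by simp)) x).hasFDerivAt
  have h3 := h1.mul h2
  refine h3.congr_fderiv ?_
  ext v
  simp only [ampD, FunLike.coe_smul, Pi.smul_apply, add_apply,
    innerC_apply, smul_eq_mul]
  ring

omit [FiniteDimensional ℝ V] [MeasurableSpace V] [BorelSpace V] in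
/-- The norm of `D(x, ξ)` is `O(⟨ξ⟩^{m+1})`, uniformly in `x`. [folklore] -/
theorem IsAmp.norm_ampD_le (ha : IsAmp a m) :
    ∃ B : ℝ, 0 ≤ B ∧ ∀ x ξ, ‖ampD a x ξ‖ ≤ B * bw (m + 1) ξ := by
  obtain ⟨C₀, hC₀, h₀⟩ := ha.norm_le
  obtain ⟨C₁, hC₁, h₁⟩ := ha.bound 1
  refine ⟨2 * π * C₀ + C₁, by positivity, fun x ξ => ?_⟩
  have hd : ‖fderiv ℝ (fun y => a y ξ) x‖ ≤ C₁ * bw m ξ := by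
    have e : ‖fderiv ℝ (fun y => a y ξ) x‖ = ‖iteratedFDeriv ℝ 1 (fun y => a y ξ) x‖ := by
      rw [← norm_iteratedFDeriv_fderiv (n := 0), norm_iteratedFDeriv_zero]
    rw [e]; exact h₁ x ξ
  have hl : ‖(2 * π * Complex.I * a x ξ) • innerC ξ‖ ≤ 2 * π * C₀ * (bw m ξ * ‖ξ‖) := by
    rw [norm_smul]
    have hn : ‖2 * π * Complex.I * a x ξ‖ = 2 * π * ‖a x ξ‖ := by
      simp [Complex.norm_real, abs_of_nonneg pi_pos.le]
    rw [hn]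
    calc 2 * π * ‖a x ξ‖ * ‖innerC ξ‖ ≤ 2 * π * (C₀ * bw m ξ) * ‖ξ‖ :=
          mul_le_mul (mul_le_mul_of_nonneg_left (h₀ x ξ) (by positivity)) (norm_innerC_le ξ)
            (norm_nonneg _) (by have := bw_nonneg m ξ; positivity)
      _ = 2 * π * C₀ * (bw m ξ * ‖ξ‖) := by ring
  have hb1 : bw m ξ * ‖ξ‖ ≤ bw (m + 1) ξ := by
    calc bw m ξ * ‖ξ‖ ≤ bw m ξ * bw 1 ξ := mul_le_mul_of_nonneg_left (norm_le_bw_one ξ) (bw_nonneg _ _)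
      _ = bw (m + 1) ξ := by rw [← bw_add]
  have hb2 : bw m ξ ≤ bw (m + 1) ξ := bw_mono (by linarith) ξ
  calc ‖ampD a x ξ‖ ≤ ‖(2 * π * Complex.I * a x ξ) • innerC ξ‖ + ‖fderiv ℝ (fun y => a y ξ) x‖ := norm_add_le _ _
    _ ≤ 2 * π * C₀ * (bw m ξ * ‖ξ‖) + C₁ * bw m ξ := add_le_add hl hd
    _ ≤ 2 * π * C₀ * bw (m + 1) ξ + C₁ * bw (m + 1) ξ :=
        add_le_add (mul_le_mul_of_nonneg_left hb1 (by positivity)) (mul_le_mul_of_nonneg_left hb2 hC₁)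
    _ = (2 * π * C₀ + C₁) * bw (m + 1) ξ := by ring

omit [FiniteDimensional ℝ V] [MeasurableSpace V] [BorelSpace V] in
/-- `ξ ↦ D(x, ξ)` is continuous. [folklore] -/
theorem IsAmp.continuous_ampD (ha : IsAmp a m) (x : V) : Continuous fun ξ => ampD a x ξ := by
  unfold ampD
  have h1 : Continuous fun ξ => (2 * π * Complex.I * a x ξ) • innerC ξ :=
    (continuous_const.mul (ha.slice' x).continuous).smul continuous_innerC
  have h2 : Continuous fun ξ => fderiv ℝ (fun y => a y ξ) x := by
    have e : (fun ξ => fderiv ℝ (fun y => a y ξ) x) =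
        fun ξ => (fderiv ℝ (uncurry a) (x, ξ)).comp (ContinuousLinearMap.inl ℝ V V) :=
      funext fun ξ => IsAmp.fderiv_slice ha.smooth x ξ
    rw [e]
    exact ((ha.smooth.continuous_fderiv (by simp)).comp (Continuous.prodMk_right x)).clm_comp continuous_const
  exact h1.add h2

/-- **Differentiation under the integral**: `ampOp a F` is differentiable with derivative
`x ↦ ∫ F(ξ) e^{2πi⟨ξ,x⟩} D(x, ξ) dξ`. [folklore] -/
theorem IsAmp.hasFDerivAt_ampOp (ha : IsAmp a m) (hF : Nice F) (x₀ : V) :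
    HasFDerivAt (ampOp a F) (∫ ξ, F ξ • (phase ξ x₀ • ampD a x₀ ξ)) x₀ := by
  obtain ⟨B, hB, hBD⟩ := ha.norm_ampD_le
  have hmeasF : ∀ x, AEStronglyMeasurable (fun ξ => phase ξ x * (a x ξ * F ξ)) volume := fun x =>
    (ha.integrable_ampOp hF x).aestronglyMeasurable
  have key := hasFDerivAt_integral_of_dominated_of_fderiv_le (μ := (volume : Measure V))
    (F := fun x ξ => phase ξ x * (a x ξ * F ξ))
    (F' := fun x ξ => F ξ • (phase ξ x • ampD a x ξ)) (x₀ := x₀) (s := univ)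
    (bound := fun ξ => B * (bw (m + 1) ξ * ‖F ξ‖)) univ_mem
    (Eventually.of_forall hmeasF) (ha.integrable_ampOp hF x₀) ?_ ?_ ?_ ?_
  · exact key
  · -- measurability of `F'`
    refine hF.1.smul ?_
    exact ((continuous_phase_left x₀).smul (ha.continuous_ampD x₀)).aestronglyMeasurable
  · -- the bound
    refine Eventually.of_forall fun ξ x _ => ?_
    rw [norm_smul, norm_smul, norm_phase, one_mul]
    calc ‖F ξ‖ * ‖ampD a x ξ‖ ≤ ‖F ξ‖ * (B * bw (m + 1) ξ) := mul_le_mul_of_nonneg_left (hBD x ξ) (norm_nonneg _)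
      _ = B * (bw (m + 1) ξ * ‖F ξ‖) := by ring
  · exact (integrable_bw_mul_norm_of_nice hF (m + 1)).const_mul B
  · refine Eventually.of_forall fun ξ x _ => ?_
    have h := (ha.hasFDerivAt_phase_mul x ξ).const_mul (F ξ)
    have e : (fun y => F ξ * (phase ξ y * a y ξ)) = fun y => phase ξ y * (a y ξ * F ξ) := by ext y; ring
    rw [e] at h
    exact h

/-- **Directional derivatives of amplitude operators**: `Z_x (ampOp a F) = ampOp (twD Z a) F`.
[folklore] -/
theorem IsAmp.dirC_ampOp (ha : IsAmp a m) (hF : Nice F) (Z : V → V) :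
    dirC Z (ampOp a F) = ampOp (twD Z a) F := by
  ext x
  rw [dirC, (ha.hasFDerivAt_ampOp hF x).fderiv]
  obtain ⟨B, hB, hBD⟩ := ha.norm_ampD_le
  have hint : Integrable (fun ξ => F ξ • (phase ξ x • ampD a x ξ)) := by
    refine hF.integrable_smul (((continuous_phase_left x).smul (ha.continuous_ampD x)).aestronglyMeasurable)
      (C := B) (p := m + 1) fun ξ => ?_
    rw [norm_smul, norm_phase, one_mul]; exact hBD x ξ
  rw [ContinuousLinearMap.integral_apply hint (Z x), ampOp]
  refine integral_congr_ae (Eventually.of_forall fun ξ => ?_)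
  simp only [FunLike.coe_smul, Pi.smul_apply, smul_eq_mul, ampD_apply]
  ring

/-- `ampOp` is additive in the amplitude. [folklore] -/
theorem IsAmp.ampOp_add (ha : IsAmp a m) {b : V → V → ℂ} {m' : ℝ} (hb : IsAmp b m') (hF : Nice F) :
    ampOp (fun x ξ => a x ξ + b x ξ) F = fun x => ampOp a F x + ampOp b F x := by
  ext x
  simp only [ampOp]
  rw [← integral_add (ha.integrable_ampOp hF x) (hb.integrable_ampOp hF x)]
  refine integral_congr_ae (Eventually.of_forall fun ξ => ?_)
  ring

/-- `ampOp` commutes with multiplication by functions of `x`. [folklore] -/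
theorem ampOp_fun_mul (g : V → ℂ) (a : V → V → ℂ) (F : V → ℂ) :
    ampOp (fun x ξ => g x * a x ξ) F = fun x => g x * ampOp a F x := by
  ext x
  simp only [ampOp]
  rw [← integral_const_mul]
  refine integral_congr_ae (Eventually.of_forall fun ξ => ?_)
  ring

/-- `ampOp (-a) F = -ampOp a F`. [folklore] -/
theorem ampOp_neg (a : V → V → ℂ) (F : V → ℂ) : ampOp (fun x ξ => -a x ξ) F = fun x => -ampOp a F x := by
  ext x
  simp only [ampOp]
  rw [← integral_neg]
  refine integral_congr_ae (Eventually.of_forall fun ξ => ?_)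
  ring

/-- **The transposes act through the twisted calculus, I**: `ᵗZ (ampOp a F) = ampOp (twT Z a) F`.
[folklore] -/
theorem IsAmp.trC_ampOp (ha : IsAmp a m) (hF : Nice F) {Z : V → V} (hZ : ContDiff ℝ ∞ Z) :
    trC Z (ampOp a F) = ampOp (twT Z a) F := by
  have h1 : twT Z a = fun x ξ => -twD Z a x ξ + (-(fieldDiv Z x : ℂ)) * a x ξ := by
    ext x ξ; simp only [twT]; ring
  rw [h1, (isAmp_twD ha hZ).neg.ampOp_add (ha.smul_fun (g := fun x => -(fieldDiv Z x : ℂ))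
    (Complex.ofRealCLM.contDiff.comp (contDiff_fieldDiv hZ)).neg) hF, ampOp_neg, ampOp_fun_mul,
    ← ha.dirC_ampOp hF Z]
  ext x; simp only [trC]; ring

/-- **The transposes act through the twisted calculus, II**: `ᵗX_w (ampOp a F) = ampOp (twW w a) F`.
[folklore] -/
theorem IsAmp.wtrC_ampOp {ι : Type*} {Y : ι → V → V} (hY : ∀ i, ContDiff ℝ ∞ (Y i)) (hF : Nice F) :
    ∀ (w : List ι) {a : V → V → ℂ} {m : ℝ}, IsAmp a m → wtrC Y w (ampOp a F) = ampOp (twW Y w a) F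
  | [], _, _, _ => rfl
  | i :: w, _, _, ha => by
    rw [wtrC_cons, twW_cons, ha.trC_ampOp hF (hY i)]
    exact IsAmp.wtrC_ampOp hY hF w (isAmp_twT ha (hY i))

/-- **The exact composition formula**: `ᵗL (ampOp a F) = ampOp (twOp a) F` — a differential
operator with smooth coefficients composed with an amplitude operator is the amplitude operator
of the twisted amplitude. [folklore] -/
theorem IsAmp.opC_ampOp {ι : Type*} {Y : ι → V → V} (hY : ∀ i, ContDiff ℝ ∞ (Y i))
    (S : Finset (List ι)) {b : List ι → V → ℝ} (hb : ∀ w, ContDiff ℝ ∞ (b w)) (ha : IsAmp a m)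
    (hF : Nice F) : opC Y S b (ampOp a F) = ampOp (twOp Y S b a) F := by
  ext x
  simp only [opC]
  have hterm : ∀ w ∈ S, wtrC Y w (fun y => (b w y : ℂ) * ampOp a F y) x =
      ampOp (twW Y w fun y η => (b w y : ℂ) * a y η) F x := by
    intro w _
    have e : (fun y => (b w y : ℂ) * ampOp a F y) = ampOp (fun y η => (b w y : ℂ) * a y η) F := by
      rw [ampOp_fun_mul]
    rw [e, IsAmp.wtrC_ampOp hY hF w (ha.smul_fun_real (hb w))]
  rw [Finset.sum_congr rfl hterm]
  simp only [ampOp]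
  rw [← integral_finsetSum]
  · refine integral_congr_ae (Eventually.of_forall fun ξ => ?_)
    show ∑ w ∈ S, phase ξ x * (twW Y w (fun y η => (b w y : ℂ) * a y η) x ξ * F ξ) =
      phase ξ x * (twOp Y S b a x ξ * F ξ)
    simp only [twOp, Finset.sum_mul, Finset.mul_sum]
  · intro w _
    exact (isAmp_twW hY w (ha.smul_fun_real (hb w))).integrable_ampOp hF x

/-! ### Smoothness and support of amplitude operators -/

/-- `ampOp a F` is differentiable. [folklore] -/
theorem IsAmp.differentiable_ampOp (ha : IsAmp a m) (hF : Nice F) : Differentiable ℝ (ampOp a F) :=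
  fun x => (ha.hasFDerivAt_ampOp hF x).differentiableAt

/-- `ampOp a F` is `C^n` for every `n` (induction on `n`: the directional derivatives are
again amplitude operators). [folklore] -/
theorem IsAmp.contDiff_ampOp_nat (hF : Nice F) :
    ∀ (n : ℕ) {a : V → V → ℂ} {m : ℝ}, IsAmp a m → ContDiff ℝ n (ampOp a F)
  | 0, _, _, ha => contDiff_zero.2 (ha.differentiable_ampOp hF).continuous
  | n + 1, a, m, ha => by
    rw [show ((n + 1 : ℕ) : ℕ∞ω) = (n : ℕ∞ω) + 1 by push_cast; rfl, contDiff_succ_iff_fderiv_apply]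
    refine ⟨ha.differentiable_ampOp hF, fun h => absurd h (by simp), fun y => ?_⟩
    have e : (fun x => fderiv ℝ (ampOp a F) x y) = ampOp (twD (fun _ => y) a) F :=
      funext fun x => congrFun (ha.dirC_ampOp hF (fun _ => y)) x
    rw [e]
    exact IsAmp.contDiff_ampOp_nat hF n (isAmp_twD ha contDiff_const)

/-- **`ampOp a F` is smooth.** [folklore] -/
theorem IsAmp.contDiff_ampOp (ha : IsAmp a m) (hF : Nice F) : ContDiff ℝ ∞ (ampOp a F) :=
  contDiff_infty.2 fun n => IsAmp.contDiff_ampOp_nat hF n ha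

/-- `ampOp a F` vanishes outside the `x`-support of `a`. [folklore] -/
theorem ampOp_eq_zero_of_forall {K : Set V} (hK : ∀ ξ, tsupport (fun x => a x ξ) ⊆ K) {x : V}
    (hx : x ∉ K) (F : V → ℂ) : ampOp a F x = 0 := by
  have h0 : ∀ ξ, a x ξ = 0 := fun ξ => image_eq_zero_of_notMem_tsupport (f := fun y => a y ξ) fun h => hx (hK ξ h)
  simp [ampOp, h0]

/-- The support of `ampOp a F` lies in any closed set containing the `x`-supports of `a`.
[folklore] -/
theorem tsupport_ampOp_subset {K : Set V} (hK : ∀ ξ, tsupport (fun x => a x ξ) ⊆ K) (hKc : IsClosed K)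
    (F : V → ℂ) : tsupport (ampOp a F) ⊆ K := by
  refine closure_minimal (fun x hx => ?_) hKc
  by_contra hxK
  exact hx (ampOp_eq_zero_of_forall hK hxK F)

/-- `ampOp a F` has compact support. [folklore] -/
theorem IsAmp.hasCompactSupport_ampOp (ha : IsAmp a m) (F : V → ℂ) : HasCompactSupport (ampOp a F) := by
  obtain ⟨K, hK, hKs⟩ := ha.supp
  exact IsCompact.of_isClosed_subset hK (isClosed_tsupport _) (tsupport_ampOp_subset hKs hK.isClosed F)

/-! ### The Fourier side of amplitude operators -/

/-- **The Fourier-side kernel** of an amplitude: `K(η, ξ) = 𝓕(a(·, ξ))(η - ξ)`. [folklore] -/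
def ampKer (a : V → V → ℂ) (η ξ : V) : ℂ := 𝓕 (fun x => a x ξ) (η - ξ)

/-- The kernel is jointly measurable (a parametric integral of a continuous function). [folklore] -/
theorem IsAmp.measurable_ampKer (ha : IsAmp a m) : Measurable (uncurry (ampKer a)) := by
  have e : uncurry (ampKer a) = fun p : V × V =>
      ∫ x, Complex.exp (↑(-2 * π * ⟪x, p.1 - p.2⟫_ℝ) * Complex.I) • a x p.2 := by
    ext ⟨η, ξ⟩; simp only [uncurry, ampKer, Real.fourier_eq']
  rw [e]
  have hexp : Continuous fun q : (V × V) × V =>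
      Complex.exp (↑(-2 * π * ⟪q.2, q.1.1 - q.1.2⟫_ℝ) * Complex.I) := by fun_prop
  have hc : Continuous fun q : (V × V) × V =>
      Complex.exp (↑(-2 * π * ⟪q.2, q.1.1 - q.1.2⟫_ℝ) * Complex.I) • a q.2 q.1.2 :=
    hexp.smul (ha.continuous.comp (continuous_snd.prodMk (continuous_snd.comp continuous_fst)))
  have hsm : StronglyMeasurable (uncurry fun (p : V × V) (x : V) =>
      Complex.exp (↑(-2 * π * ⟪x, p.1 - p.2⟫_ℝ) * Complex.I) • a x p.2) := hc.stronglyMeasurable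
  exact (hsm.integral_prod_right (ν := volume)).measurable

/-- `(1 + t)^N ≤ 2^N (1 + t^N)` for `t ≥ 0`. [folklore] -/
theorem one_add_pow_le_two_pow_mul {t : ℝ} (ht : 0 ≤ t) (N : ℕ) : (1 + t) ^ N ≤ 2 ^ N * (1 + t ^ N) := by
  have h1 : 1 + t ≤ 2 * max 1 t := by
    have := le_max_left 1 t; have := le_max_right 1 t; linarith
  have h2 : (max 1 t) ^ N ≤ 1 + t ^ N := by
    rcases le_total t 1 with h | h
    · rw [max_eq_left h, one_pow]; have := pow_nonneg ht N; linarith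
    · rw [max_eq_right h]; linarith
  calc (1 + t) ^ N ≤ (2 * max 1 t) ^ N := pow_le_pow_left₀ (by linarith) h1 N
    _ = 2 ^ N * (max 1 t) ^ N := mul_pow _ _ _
    _ ≤ 2 ^ N * (1 + t ^ N) := mul_le_mul_of_nonneg_left h2 (by positivity)

/-- **Decay of the `x`-Fourier transform of an amplitude**: `‖ζ‖^N ‖𝓕(a(·,ξ))(ζ)‖ ≤ C_N ⟨ξ⟩^m`
(integration by parts `N` times, via Mathlib's `pow_mul_norm_iteratedFDeriv_fourier_le`, and the
compact `x`-support). [folklore] -/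
theorem IsAmp.exists_pow_mul_norm_fourier_le (ha : IsAmp a m) (N : ℕ) :
    ∃ C : ℝ, 0 ≤ C ∧ ∀ ξ ζ : V, ‖ζ‖ ^ N * ‖𝓕 (fun x => a x ξ) ζ‖ ≤ C * bw m ξ := by
  obtain ⟨K, hK, hKs⟩ := ha.supp
  choose C hC0 hC using ha.bound
  set vol : ℝ := volume.real K with hvol
  have hvol0 : 0 ≤ vol := measureReal_nonneg
  have hsum0 : 0 ≤ ∑ j ∈ Finset.range (N + 1), C j := Finset.sum_nonneg fun j _ => hC0 j
  refine ⟨(2 * π) ^ (0 : ℕ) * (2 * (0 : ℕ) + 2) ^ N * ((∑ j ∈ Finset.range (N + 1), C j) * vol),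
    by positivity, fun ξ ζ => ?_⟩
  set f : V → ℂ := fun x => a x ξ with hf_def
  have hf : ContDiff ℝ ∞ f := ha.slice ξ
  have hfs : HasCompactSupport f := IsCompact.of_isClosed_subset hK (isClosed_tsupport _) (hKs ξ)
  have hint : ∀ k n : ℕ, (k : ℕ∞) ≤ (0 : ℕ∞) → (n : ℕ∞) ≤ (⊤ : ℕ∞) →
      Integrable (fun v => ‖v‖ ^ k * ‖iteratedFDeriv ℝ n f v‖) := by
    intro k n _ _
    refine Continuous.integrable_of_hasCompactSupport ?_ ?_
    · exact (continuous_norm.pow k).mul (hf.continuous_iteratedFDeriv (mod_cast le_top)).norm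
    · exact ((hfs.iteratedFDeriv n).norm).mul_left
  have h := Real.pow_mul_norm_iteratedFDeriv_fourier_le (K := (0 : ℕ∞)) (N := (⊤ : ℕ∞)) (f := f)
    (mod_cast hf) hint (k := 0) (n := N) le_rfl le_top ζ
  rw [norm_iteratedFDeriv_zero] at h
  refine h.trans ?_
  have hsum : ∑ p ∈ Finset.range (0 + 1) ×ˢ Finset.range (N + 1),
      ∫ v, ‖v‖ ^ p.1 * ‖iteratedFDeriv ℝ p.2 f v‖ ≤ (∑ j ∈ Finset.range (N + 1), C j) * vol * bw m ξ := by
    rw [Finset.sum_product, zero_add, Finset.sum_range_one, Finset.sum_mul, Finset.sum_mul]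
    refine Finset.sum_le_sum fun j _ => ?_
    simp only [pow_zero, one_mul]
    have hzero : ∀ v ∉ K, ‖iteratedFDeriv ℝ j f v‖ = 0 := fun v hv => by
      rw [IsAmp.iteratedFDeriv_eq_zero hKs hv j ξ, norm_zero]
    rw [← setIntegral_eq_integral_of_forall_compl_eq_zero hzero]
    have hb := norm_setIntegral_le_of_norm_le_const (μ := (volume : Measure V)) (s := K)
      (f := fun v => ‖iteratedFDeriv ℝ j f v‖) hK.measure_lt_top (C := C j * bw m ξ) fun v _ => by
        rw [norm_norm]; exact hC j v ξ
    have hnn : 0 ≤ ∫ v in K, ‖iteratedFDeriv ℝ j f v‖ := integral_nonneg fun v => norm_nonneg _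
    rw [Real.norm_of_nonneg hnn] at hb
    calc ∫ v in K, ‖iteratedFDeriv ℝ j f v‖ ≤ C j * bw m ξ * volume.real K := hb
      _ = C j * vol * bw m ξ := by rw [hvol]; ring
  calc (2 * π) ^ (0 : ℕ) * (2 * (0 : ℕ) + 2) ^ N *
        ∑ p ∈ Finset.range (0 + 1) ×ˢ Finset.range (N + 1), ∫ v, ‖v‖ ^ p.1 * ‖iteratedFDeriv ℝ p.2 f v‖
      ≤ (2 * π) ^ (0 : ℕ) * (2 * (0 : ℕ) + 2) ^ N * ((∑ j ∈ Finset.range (N + 1), C j) * vol * bw m ξ) :=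
        mul_le_mul_of_nonneg_left hsum (by positivity)
    _ = _ := by ring

/-- **The kernel of an amplitude of order `m` is certified of order `m`** (rapid decay off the
diagonal from the decay of the `x`-Fourier transform). [folklore] -/
theorem IsAmp.kerDecay_ampKer (ha : IsAmp a m) : ∃ C : ℕ → ℝ, KerDecay (ampKer a) m C := by
  choose A hA0 hA using fun N => ha.exists_pow_mul_norm_fourier_le N
  refine ⟨fun N => 2 ^ N * (A 0 + A N), ⟨ha.measurable_ampKer, fun N => by
    have := hA0 0; have := hA0 N; positivity, fun N η ξ => ?_⟩⟩
  set ζ : V := η - ξ with hζ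
  have h0 : ‖ampKer a η ξ‖ ≤ A 0 * bw m ξ := by
    have := hA 0 ξ ζ; rw [pow_zero, one_mul] at this; exact this
  have hN : ‖ζ‖ ^ N * ‖ampKer a η ξ‖ ≤ A N * bw m ξ := hA N ξ ζ
  -- `⟨ζ⟩^N ‖K‖ ≤ 2^N (A 0 + A N) ⟨ξ⟩^m`
  have hmain : bw N ζ * ‖ampKer a η ξ‖ ≤ 2 ^ N * (A 0 + A N) * bw m ξ := by
    have h1 : bw N ζ ≤ 2 ^ N * (1 + ‖ζ‖ ^ N) :=
      (bw_natCast_le N ζ).trans (one_add_pow_le_two_pow_mul (norm_nonneg ζ) N)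
    calc bw N ζ * ‖ampKer a η ξ‖ ≤ 2 ^ N * (1 + ‖ζ‖ ^ N) * ‖ampKer a η ξ‖ :=
          mul_le_mul_of_nonneg_right h1 (norm_nonneg _)
      _ = 2 ^ N * (‖ampKer a η ξ‖ + ‖ζ‖ ^ N * ‖ampKer a η ξ‖) := by ring
      _ ≤ 2 ^ N * (A 0 * bw m ξ + A N * bw m ξ) := mul_le_mul_of_nonneg_left (add_le_add h0 hN) (by positivity)
      _ = 2 ^ N * (A 0 + A N) * bw m ξ := by ring
  calc ‖ampKer a η ξ‖ = bw N ζ * ‖ampKer a η ξ‖ * bw (-N) ζ := by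
        rw [mul_comm (bw N ζ), mul_assoc, bw_mul_bw_neg, mul_one]
    _ ≤ 2 ^ N * (A 0 + A N) * bw m ξ * bw (-N) ζ := mul_le_mul_of_nonneg_right hmain (bw_nonneg _ _)
    _ = 2 ^ N * (A 0 + A N) * bw (-N) (η - ξ) * bw m ξ := by rw [hζ]; ring

/-- **The Fourier transform of an amplitude operator is the kernel operator of its kernel**:
`𝓕 (ampOp a F) = kerOp (ampKer a) F` (Fubini). [folklore] -/
theorem IsAmp.fourier_ampOp (ha : IsAmp a m) (hF : Nice F) : 𝓕 (ampOp a F) = kerOp (ampKer a) F := by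
  obtain ⟨K, hK, hKs⟩ := ha.supp
  obtain ⟨C, hC0, hC⟩ := ha.norm_le
  ext η
  rw [Real.fourier_eq', kerOp]
  -- the integrand on `V × V`
  set G : V → V → ℂ := fun x ξ => Complex.exp (↑(-2 * π * ⟪x, η⟫_ℝ) * Complex.I) *
    (phase ξ x * (a x ξ * F ξ)) with hG
  have hGi : Integrable (uncurry G) (volume.prod volume) := by
    have hm : AEStronglyMeasurable (uncurry G) (volume.prod volume) := by
      have h1 : Continuous fun p : V × V => Complex.exp (↑(-2 * π * ⟪p.1, η⟫_ℝ) * Complex.I) *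
          (phase p.2 p.1 * a p.1 p.2) := by
        refine Continuous.mul (by fun_prop) (Continuous.mul ?_ ha.continuous)
        exact continuous_phase.comp (continuous_snd.prodMk continuous_fst)
      have h2 : AEStronglyMeasurable (fun p : V × V => F p.2) (volume.prod volume) := hF.1.comp_snd
      have e : uncurry G = fun p : V × V => (Complex.exp (↑(-2 * π * ⟪p.1, η⟫_ℝ) * Complex.I) *
          (phase p.2 p.1 * a p.1 p.2)) * F p.2 := by
        ext ⟨x, ξ⟩; simp only [uncurry, hG]; ring
      rw [e]; exact h1.aestronglyMeasurable.mul h2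
    have hind : Integrable (K.indicator fun _ : V => (1 : ℝ)) (volume : Measure V) :=
      (integrable_indicator_iff hK.measurableSet).2 (integrableOn_const (hK.measure_lt_top).ne)
    have hmaj : Integrable (fun p : V × V => K.indicator (fun _ => (1 : ℝ)) p.1 * (C * (bw m p.2 * ‖F p.2‖)))
        (volume.prod volume) := hind.mul_prod ((integrable_bw_mul_norm_of_nice hF m).const_mul C)
    refine hmaj.mono' hm (Eventually.of_forall fun p => ?_)
    rcases p with ⟨x, ξ⟩
    simp only [uncurry, hG, norm_mul, Complex.norm_exp_ofReal_mul_I, norm_phase, one_mul]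
    by_cases hx : x ∈ K
    · rw [indicator_of_mem hx, one_mul]
      calc ‖a x ξ‖ * ‖F ξ‖ ≤ C * bw m ξ * ‖F ξ‖ := mul_le_mul_of_nonneg_right (hC x ξ) (norm_nonneg _)
        _ = C * (bw m ξ * ‖F ξ‖) := by ring
    · have : a x ξ = 0 := image_eq_zero_of_notMem_tsupport (f := fun y => a y ξ) fun h => hx (hKs ξ h)
      rw [this, norm_zero, zero_mul, indicator_of_notMem hx, zero_mul]
  have hswap := integral_integral_swap hGi
  -- left side as an iterated integral
  have e1 : (fun x => Complex.exp (↑(-2 * π * ⟪x, η⟫_ℝ) * Complex.I) • ampOp a F x) = fun x => ∫ ξ, G x ξ := by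
    ext x; simp only [ampOp, smul_eq_mul, hG]; rw [← integral_const_mul]
  rw [e1, hswap]
  refine integral_congr_ae (Eventually.of_forall fun ξ => ?_)
  -- `∫ x, G x ξ = ampKer a η ξ * F ξ`
  show ∫ x, G x ξ = ampKer a η ξ * F ξ
  rw [ampKer, Real.fourier_eq', ← integral_mul_const]
  refine integral_congr_ae (Eventually.of_forall fun x => ?_)
  simp only [hG, phase, smul_eq_mul, inner_sub_right]
  have e2 : Complex.exp (↑(-2 * π * ⟪x, η⟫_ℝ) * Complex.I) * Complex.exp (↑(2 * π * ⟪ξ, x⟫_ℝ) * Complex.I) =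
      Complex.exp (↑(-2 * π * (⟪x, η⟫_ℝ - ⟪x, ξ⟫_ℝ)) * Complex.I) := by
    rw [← Complex.exp_add, real_inner_comm x ξ]; congr 1; push_cast; ring
  calc Complex.exp (↑(-2 * π * ⟪x, η⟫_ℝ) * Complex.I) * (Complex.exp (↑(2 * π * ⟪ξ, x⟫_ℝ) * Complex.I) * (a x ξ * F ξ))
      = (Complex.exp (↑(-2 * π * ⟪x, η⟫_ℝ) * Complex.I) * Complex.exp (↑(2 * π * ⟪ξ, x⟫_ℝ) * Complex.I)) *
          a x ξ * F ξ := by ring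
    _ = Complex.exp (↑(-2 * π * (⟪x, η⟫_ℝ - ⟪x, ξ⟫_ℝ)) * Complex.I) * a x ξ * F ξ := by rw [e2]

/-- **The Sobolev bound of an amplitude operator of order `m`** (Fourier side): there is `C`
with `‖𝓕(ampOp a F)‖_{s-m} ≤ C ‖F‖_s` for all `Nice F`. [folklore] -/
theorem IsAmp.exists_wnorm_fourier_ampOp_le (ha : IsAmp a m) (s : ℝ) :
    ∃ C : ℝ, 0 ≤ C ∧ ∀ F : V → ℂ, Nice F → wnorm (s - m) (𝓕 (ampOp a F)) ≤ ENNReal.ofReal C * wnorm s F := by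
  obtain ⟨C, hKd⟩ := ha.kerDecay_ampKer
  refine ⟨schurConst V (s - m) C, schurConst_nonneg hKd.nonneg _, fun F hF => ?_⟩
  rw [ha.fourier_ampOp hF]
  exact wnorm_kerOp_le hKd s hF.1

/-- The Fourier transform of an amplitude operator applied to `Nice` data is `Nice`. [folklore] -/
theorem IsAmp.nice_fourier_ampOp (ha : IsAmp a m) (hF : Nice F) : Nice (𝓕 (ampOp a F)) := by
  obtain ⟨C, hKd⟩ := ha.kerDecay_ampKer
  rw [ha.fourier_ampOp hF]
  exact hKd.nice_kerOp hF

/-- `ampOp a F` is integrable (continuous with compact support). [folklore] -/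
theorem IsAmp.integrable_ampOp_fun (ha : IsAmp a m) (hF : Nice F) : Integrable (ampOp a F) :=
  (ha.contDiff_ampOp hF).continuous.integrable_of_hasCompactSupport (ha.hasCompactSupport_ampOp F)

end Literature.Analysis.Hypoelliptic
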